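import Literature.Analysis.FluidPDE.ESSLocalHolderBlowupRestart
import Literature.Analysis.FluidPDE.LocalLerayBackwardUniquenessAnyDatum
import Literature.Analysis.FunctionSpaces.WeakLpQuantitative
import HarnessLib

/-!
# Seregin 2019, §4 (proof of Prop. 1.3), the endgame: a local energy ancient solution with
# weak-`L³` slices which vanishes at the final time is identically zero

Analysis/FluidPDE proofs-only file (theorems only: no definitions, no named facts, no `sorry`),
tranche (W3)+(W4) of the input `Literature.Analysis.FluidPDE.seregin2019_localWeakL3_epsRegularity`
(`Seregin2019LocalWeakL3.lean`; G. Seregin, *A note on weak solutions to the Navier–Stokes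
equations that are locally in `L_∞(L^{3,∞})`*, arXiv:1906.06707 = St. Petersburg Math. J. 32
(2021) 565–576, Prop. 1.3/1.4). No Navier–Stokes regularity statement is proved here.

The printed proof of Prop. 1.3 (§4, pp. 7–8) argues ad absurdum: rescaling and two compactness
passages produce "a local energy ancient solution `w` with the associated pressure `r`" on
`ℝ³ × ]-∞, 0[` with `Θ(w, r, ϱ; z₀) + Σ(w, r, ϱ) ≤ c(M, N)`,
`‖w‖_{L_∞(-∞,0; L^{3,∞}(ℝ³))} ≤ M`, `w(x, 0) = 0` for all `x ∈ ℝ³` and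
`∫_Q |w|³ ≥ ε⋆(N)/2 > 0`; then the far-field decay of weak-`L³` fields (repeated from
Choe–Wolf–Yang) makes the backward uniqueness approach of [ESS2003] applicable — "we show that
`w ≡ 0` in `ℝ³ × ]-1, 0[`. This is a contradiction." This file proves that **endgame** in the
tree's vocabulary, for the class of limits the compactness theorem on expanding balls delivers
(`LocalTypeIBlowup.local_suitableCompactness`: a pair `(w, π)` suitable in every parabolic ball
`Q(a) = ]-a², 0[ × B(a)` with `w ∈ L³(Q(a))`):

* `Seregin2019.exists_restart_weakL3` — the weak-`L³` twin of the tree's `ESSBlowup.exists_restart`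
  (the `L_{3,∞}` case of ESS 2003, Thm. 1.4): if in addition the slices `w(s)` are weak-`L³`
  uniformly for a.e. `s < 0`, `w` has a weak spatial gradient on the half-space with uniformly
  local dissipation, and the pairings `∫⟪w(s), φ⟫` with test fields vanish essentially as
  `s ↑ 0`, then for every `T > 0` there are `s₀ ∈ ]-T, -T/2[` and a representative `W` of
  `t ↦ w(s₀ + t)` such that `(W, π(s₀ + ·))` is a local Leray solution on `(0, -s₀) × ℝ³` with
  datum `w(s₀)` (`IsLocalLeraySolutionOn`, Lemarié-Rieusset's Def. 14.1 with Kang–Miura–Tsai's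
  clauses), the datum is weakly divergence free, the pairings `∫⟪W(t), φ⟫` tend to `0` as
  `t ↑ -s₀`, and `W = 0` a.e. on the strip forces `w = 0` a.e. on `]s₀, 0[ × ℝ³`.
  The proof is the tree's, with the `L³` inputs replaced: the uniformly local energy of the
  slices and the `L²(B)` bound of good slices come from `L^{3,∞} ⊂ L²_uloc`
  (`MemWeakLp.setLIntegral_enorm_sq_le_of_three`, Bradshaw–Tsai), the decay clause (7) of the
  local Leray class from the truncation of weak-`L³` fields at a small height
  (`MemWeakLp.lintegral_rpow_indicator_lt_norm_le`: `∫ |w|² 𝟙_{|w|>γ} ≤ 3 γ⁻¹ ‖w‖³_{L^{3,∞}}`, an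
  integrable majorant on the slab — this is the far-field step "just for completeness, we repeat
  arguments from the paper [CWY]" of p. 8), the uniformly local dissipation is the hypothesis
  (in print: `Θ ≤ c(M, N)`, in particular `E(w, ϱ; z₀) ≤ c(M, N)` for all `ϱ`, `z₀`), and the
  datum needs no `L³` membership because the backward uniqueness theorem is used in its
  any-datum form.
* `Seregin2019.ae_zero_of_weakL3_ancient_top_vanishing` — under the same hypotheses `w = 0`
  a.e. on `]-T, 0[ × ℝ³` for every `T > 0`: the restart fed to
  `IsLocalLeraySolutionOn.ae_zero_of_final_vanishing_anyDatum` (Lemarié-Rieusset 2016, Thm. 15.4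
  with the `L³` hypothesis on the datum removed, PROVED in the tree along ESS 2003, §5: far-field
  regularity, backward uniqueness, unique continuation).
* `Seregin2019.lintegral_cube_eq_zero_of_weakL3_ancient_top_vanishing` — hence
  `∫_{Q(a)} |w|³ = 0` for every `a > 0`, the form that contradicts `∫_Q |w|³ ≥ ε⋆/2`.

Deviation from print (a genuinely shorter road, recorded here as required): Seregin restarts
nothing — he applies ESS's backward uniqueness and unique continuation to `w` directly after the
CWY far-field regularity; the tree's packaged form of that argument is Thm. 15.4 for local Leray
solutions on a slab, so the ancient solution is restarted at an a.e. good time `s₀`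
(Lemarié-Rieusset 2016, p. 568: "for almost every `T₃`, `u` is a local Leray solution on
`(T₃, T₁)`"), exactly as the tree's discharge of ESS Thm. 1.4 does
(`noConcentration_of_backward_uniqueness`, `ESSLocalHolderOfBackwardUniqueness.lean`).

Not here (the remaining tranches of the input, see the cell's kit note): the negation
bookkeeping of Prop. 1.3, the one-scale regularity with bounded pressure oscillation (Prop. 4.1 =
Seregin 2016), the rescaling and the compactness passage producing `(w, π)` with the hypotheses
below and `∫_Q |w|³ ≥ ε⋆/2`, and the scaling Prop. 1.3 ⇒ Prop. 1.4.

## Mathlib / tree search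

Reused by name: `ESSBlowup.isSuitableWeakSolutionOn_halfspace`,
`ESSBlowup.locallyIntegrableOn_cube_halfspace`, `SuitableRestart.ae_tendsto_lintegral_ball_sub_sq`,
`SuitableRestart.ae_isWeaklyDivFree_slice`, `exists_dense_seq_isTestFunctionOn`,
`IsSuitableWeakSolutionOn.timeShift/.congr_ae`, `HasWeakSpatialGradientOn.timeShift/.congr_ae`,
`setLIntegral_prod_timeShift`, `measurePreserving_timeShift_restrict`,
`aestronglyMeasurable_slab_of_forall_cylinder`, `MemWeakLp.setLIntegral_enorm_sq_le_of_three`,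
`MemWeakLp.lintegral_rpow_indicator_lt_norm_le`,
`IsLocalLeraySolutionOn.ae_zero_of_final_vanishing_anyDatum`
(`lean search 'exists_restart|weakL3|ae_zero_of_final_vanishing'`, 2026-08-28: the `L³` restart
and the bounded-mild weak-`L³` Liouville theorem `AlbrittonBarker2019_liouville_weakL3_backward_holds`
only; no statement for suitable pairs with weak-`L³` slices).

## References

* G. Seregin, arXiv:1906.06707 (2019), §4, proof of Prop. 1.3, pp. 7–8 (the ancient solution
  `w`, its properties, the CWY far-field step, "using arguments of the paper [ESS2003], we show
  that `w ≡ 0`"). [`Seregin2019`]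
* L. Escauriaza, G. Seregin, V. Šverák, Russ. Math. Surveys 58:2 (2003) 211–250, §3 and §5.
  [`EscauriazaSereginSverak2003`]
* P. G. Lemarié-Rieusset, *The Navier–Stokes Problem in the 21st Century* (2016), Def. 14.1,
  Thm. 15.4 and its proof (PDF p. 568). [`LemarieRieusset2016`]
* H. J. Choe, J. Wolf, M. Yang, Math. Ann. 370 (2018), the far-field decay of weak-`L³` fields. [CWY]
* Z. Bradshaw, T.-P. Tsai, Ann. Henri Poincaré 18 (2017), §1 (`L³_w ⊂ L²_uloc`). [`BradshawTsai2017AHP`]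
-/

noncomputable section

open MeasureTheory Set Function Filter Topology TopologicalSpace Metric
open scoped NNReal ENNReal InnerProductSpace RealInnerProductSpace

namespace Literature.Analysis.FluidPDE

namespace Seregin2019

open Literature.Analysis.FunctionSpaces

variable {w : ℝ → EuclideanSpace ℝ (Fin 3) → EuclideanSpace ℝ (Fin 3)}
  {π : ℝ → EuclideanSpace ℝ (Fin 3) → ℝ}

/-! ### Boxes `]-T, 0[ × K`: integrability from the parabolic balls -/

/-- A box `]-T, 0[ × K` with `K` bounded lies in some parabolic ball `Q(a)`, `a > 0`. [folklore] -/
private theorem exists_box_subset_parabolicCylinder {T : ℝ} {K : Set (EuclideanSpace ℝ (Fin 3))}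
    (hK : Bornology.IsBounded K) :
    ∃ a : ℝ, 0 < a ∧ Ioo (-T) 0 ×ˢ K ⊆ parabolicCylinder a (0 : ℝ × EuclideanSpace ℝ (Fin 3)) := by
  obtain ⟨r, hr⟩ := hK.subset_ball (0 : EuclideanSpace ℝ (Fin 3))
  set a : ℝ := max (max r (Real.sqrt (max T 0))) 0 + 1 with ha
  have ha0 : 0 < a := by rw [ha]; linarith [le_max_right (max r (Real.sqrt (max T 0))) 0]
  have har : r ≤ a := by
    rw [ha]
    linarith [le_max_left r (Real.sqrt (max T 0)), le_max_left (max r (Real.sqrt (max T 0))) 0]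
  have haT : T ≤ a ^ 2 := by
    have h1 : Real.sqrt (max T 0) ≤ a := by
      rw [ha]
      linarith [le_max_right r (Real.sqrt (max T 0)), le_max_left (max r (Real.sqrt (max T 0))) 0]
    have h2 : max T 0 = Real.sqrt (max T 0) ^ 2 := (Real.sq_sqrt (le_max_right T 0)).symm
    calc T ≤ max T 0 := le_max_left T 0
      _ = Real.sqrt (max T 0) ^ 2 := h2
      _ ≤ a ^ 2 := pow_le_pow_left₀ (Real.sqrt_nonneg _) h1 2
  refine ⟨a, ha0, ?_⟩
  rw [SuitableCompactness.parabolicCylinder_zero]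
  exact prod_mono (Ioo_subset_Ioo (by linarith) le_rfl) (hr.trans (Metric.ball_subset_ball har))

/-- `|w|³` is integrable on every parabolic ball `Q(a)` when `w ∈ L³(Q(a))`. [folklore] -/
private theorem lintegral_cylinder_cube_lt_top
    (hw3 : ∀ a : ℝ, 0 < a → MemLp (uncurry w) 3
      (volume.restrict (parabolicCylinder a (0 : ℝ × EuclideanSpace ℝ (Fin 3)))))
    {a : ℝ} (ha : 0 < a) :
    ∫⁻ z in parabolicCylinder a (0 : ℝ × EuclideanSpace ℝ (Fin 3)), ‖w z.1 z.2‖ₑ ^ (3 : ℕ) < ∞ := by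
  have h := lintegral_rpow_enorm_lt_top_of_eLpNorm_lt_top (by norm_num) (by norm_num)
    (hw3 a ha).eLpNorm_lt_top
  rw [ENNReal.toReal_ofNat] at h
  refine lt_of_le_of_lt (le_of_eq (lintegral_congr fun z => ?_)) h
  rw [show (3 : ℝ) = ((3 : ℕ) : ℝ) by norm_num, ENNReal.rpow_natCast]
  rfl

/-- The limit lies in `L²(]-T, 0[ × K)` for every bounded `K` (`|w|² ≤ 1 + |w|³` on the
parabolic ball containing the box). [folklore] -/
private theorem lintegral_box_sq_lt_top
    (hw3 : ∀ a : ℝ, 0 < a → MemLp (uncurry w) 3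
      (volume.restrict (parabolicCylinder a (0 : ℝ × EuclideanSpace ℝ (Fin 3)))))
    (T : ℝ) {K : Set (EuclideanSpace ℝ (Fin 3))} (hK : Bornology.IsBounded K) :
    ∫⁻ z in Ioo (-T) 0 ×ˢ K, ‖w z.1 z.2‖ₑ ^ 2 < ∞ := by
  obtain ⟨a, ha, hsub⟩ := exists_box_subset_parabolicCylinder (T := T) hK
  have hvol : volume (parabolicCylinder a (0 : ℝ × EuclideanSpace ℝ (Fin 3))) < ∞ := by
    rw [SuitableCompactness.parabolicCylinder_zero, Measure.volume_eq_prod, Measure.prod_prod]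
    exact ENNReal.mul_lt_top measure_Ioo_lt_top measure_ball_lt_top
  have hsq : ∀ x : ℝ≥0∞, x ^ 2 ≤ 1 + x ^ 3 := fun x => by
    rcases le_or_gt x 1 with h | h
    · exact (pow_le_one₀ (zero_le) h).trans le_self_add
    · exact (pow_le_pow_right₀ h.le (by norm_num)).trans le_add_self
  refine lt_of_le_of_lt (lintegral_mono_set hsub) ?_
  calc ∫⁻ z in parabolicCylinder a (0 : ℝ × EuclideanSpace ℝ (Fin 3)), ‖w z.1 z.2‖ₑ ^ 2
      ≤ ∫⁻ z in parabolicCylinder a (0 : ℝ × EuclideanSpace ℝ (Fin 3)), (1 + ‖w z.1 z.2‖ₑ ^ (3 : ℕ)) :=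
        lintegral_mono fun z => hsq _
    _ = volume (parabolicCylinder a (0 : ℝ × EuclideanSpace ℝ (Fin 3))) +
          ∫⁻ z in parabolicCylinder a (0 : ℝ × EuclideanSpace ℝ (Fin 3)), ‖w z.1 z.2‖ₑ ^ (3 : ℕ) := by
        rw [lintegral_add_left measurable_const, lintegral_const, Measure.restrict_apply_univ, one_mul]
    _ < ∞ := ENNReal.add_lt_top.2 ⟨hvol, lintegral_cylinder_cube_lt_top hw3 ha⟩

/-- The pressure lies in `L^{3/2}(]-T, 0[ × K)` for every bounded `K` (it lies in
`L^{3/2}(Q(a))` for every `a`, a clause of `IsSuitableWeakSolutionInBall`). [folklore] -/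
private theorem lintegral_box_pressure_lt_top
    (hw : ∀ a : ℝ, 0 < a → IsSuitableWeakSolutionInBall a (0 : ℝ × EuclideanSpace ℝ (Fin 3)) w π)
    (T : ℝ) {K : Set (EuclideanSpace ℝ (Fin 3))} (hK : Bornology.IsBounded K) :
    ∫⁻ z in Ioo (-T) 0 ×ˢ K, ‖π z.1 z.2‖ₑ ^ (3 / 2 : ℝ) < ∞ := by
  obtain ⟨a, ha, hsub⟩ := exists_box_subset_parabolicCylinder (T := T) hK
  have h := lintegral_rpow_enorm_lt_top_of_eLpNorm_lt_top (by norm_num)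
    (ENNReal.div_lt_top (by norm_num) (by norm_num)).ne (hw a ha).2.2.2.eLpNorm_lt_top
  have e : ((3 / 2 : ℝ≥0∞)).toReal = (3 / 2 : ℝ) := by
    rw [ENNReal.toReal_div, ENNReal.toReal_ofNat, ENNReal.toReal_ofNat]
  rw [e] at h
  exact lt_of_le_of_lt (lintegral_mono_set hsub) h

/-! ### Slices: uniformly local energy and decay at spatial infinity from weak `L³` -/

/-- **`L^{3,∞} ⊂ L²_uloc` for the slices**: if for a.e. `s < 0` the slice `w(s)` is weak-`L³`
with `sup_t t³ |{|w(s)| > t}| ≤ W`, then for every radius `R` and a.e. `s < 0`,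
`∫_{B(x₀,R)} |w(s)|² ≤ |B_R| + 2W` for **every** centre `x₀` (Bradshaw–Tsai 2017, §1;
Seregin 2019, §2, first display: `A ≤ c M²`). [cite: BradshawTsai2017AHP, §1 (L^3_w ⊂ L^2_uloc)] -/
theorem exists_ae_forall_lintegral_ball_sq_le_weakL3 {W : ℝ≥0∞} (hW : W ≠ ∞)
    (hweak : ∀ᵐ s ∂(volume.restrict (Iio (0 : ℝ))),
      AEStronglyMeasurable (w s) volume ∧ eWeakLpPow (w s) 3 volume ≤ W)
    (R : ℝ) :
    ∃ C : ℝ≥0∞, C ≠ ∞ ∧ ∀ᵐ s ∂(volume.restrict (Iio (0 : ℝ))), ∀ x₀ : EuclideanSpace ℝ (Fin 3),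
      ∫⁻ x in ball x₀ R, ‖w s x‖ₑ ^ 2 ≤ C := by
  refine ⟨volume (ball (0 : EuclideanSpace ℝ (Fin 3)) R) + 2 * W,
    ENNReal.add_ne_top.2 ⟨measure_ball_lt_top.ne, ENNReal.mul_ne_top (by norm_num) hW⟩, ?_⟩
  filter_upwards [hweak] with s hs x₀
  calc ∫⁻ x in ball x₀ R, ‖w s x‖ₑ ^ 2
      ≤ volume (ball x₀ R) + 2 * eWeakLpPow (w s) 3 volume :=
        MemWeakLp.setLIntegral_enorm_sq_le_of_three hs.1 _
    _ = volume (ball (0 : EuclideanSpace ℝ (Fin 3)) R) + 2 * eWeakLpPow (w s) 3 volume := by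
        rw [Measure.addHaar_ball_center]
    _ ≤ volume (ball (0 : EuclideanSpace ℝ (Fin 3)) R) + 2 * W := by gcongr; exact hs.2

/-- The truncation of a field at height `γ`: pointwise, `|f|² ≤ γ² + |f 𝟙_{|f|>γ}|²`. [folklore] -/
private theorem enorm_sq_le_add_indicator {X : Type*} (f : X → EuclideanSpace ℝ (Fin 3)) (γ : ℝ)
    (x : X) :
    ‖f x‖ₑ ^ 2 ≤ ENNReal.ofReal (γ ^ 2) + ‖{x | γ < ‖f x‖}.indicator f x‖ₑ ^ 2 := by
  by_cases hx : γ < ‖f x‖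
  · rw [indicator_of_mem (show x ∈ {x | γ < ‖f x‖} from hx)]
    exact le_add_self
  · have hle : ‖f x‖ ≤ γ := not_lt.1 hx
    refine le_add_right ?_
    rw [← ofReal_norm, ← ENNReal.ofReal_pow (norm_nonneg _)]
    exact ENNReal.ofReal_le_ofReal (pow_le_pow_left₀ (norm_nonneg _) hle 2)

/-- **Decay of the local energy at spatial infinity from weak `L³`** (the decay clause (7) of the
local Leray class for the ancient solution; Seregin 2019, p. 8, "by the definition of weak Lebesgue
spaces … for any positive number `η` there exists `R = R(γ)`", after Choe–Wolf–Yang): if `w` is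
measurable on the slabs `]-T, 0[ × ℝ³` and its slices are weak-`L³` with `sup_t t³|{|w(s)|>t}| ≤ W`
for a.e. `s < 0`, then `∫∫_{]-T,0[ × B(x₀,R)} |w|² → 0` as `|x₀| → ∞`. Proof: truncate at a
height `γ` with `γ² · |]-T,0[ × B_R| ≤ ε/2`; the high part `|w|² 𝟙_{|w|>γ}` has slices of mass
`≤ 3γ⁻¹ W` (`MemWeakLp.lintegral_rpow_indicator_lt_norm_le`), so it is integrable on the slab and
its integral over far-away boxes tends to zero (dominated convergence).
[cite: Seregin2019, §4 p. 8 (far-field smallness from the weak-L³ bound)] -/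
theorem tendsto_lintegral_box_sq_cocompact_weakL3 {W : ℝ≥0∞} (hW : W ≠ ∞) {T : ℝ}
    (hwm : AEStronglyMeasurable (uncurry w)
      (volume.restrict (Ioo (-T) 0 ×ˢ (univ : Set (EuclideanSpace ℝ (Fin 3))))))
    (hweak : ∀ᵐ s ∂(volume.restrict (Iio (0 : ℝ))),
      AEStronglyMeasurable (w s) volume ∧ eWeakLpPow (w s) 3 volume ≤ W)
    (R : ℝ) :
    Tendsto (fun x₀ : EuclideanSpace ℝ (Fin 3) =>
        ∫⁻ z in Ioo (-T) 0 ×ˢ ball x₀ R, ‖w z.1 z.2‖ₑ ^ 2)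
      (cocompact (EuclideanSpace ℝ (Fin 3))) (𝓝 0) := by
  -- ## the slab, its product structure, the box volume
  set S : Set (ℝ × EuclideanSpace ℝ (Fin 3)) := Ioo (-T) 0 ×ˢ (univ : Set (EuclideanSpace ℝ (Fin 3)))
    with hS
  have hSm : MeasurableSet S := measurableSet_Ioo.prod MeasurableSet.univ
  have hprod : (volume.restrict S : Measure (ℝ × EuclideanSpace ℝ (Fin 3))) =
      (volume.restrict (Ioo (-T) 0)).prod (volume : Measure (EuclideanSpace ℝ (Fin 3))) := by
    rw [hS, Measure.volume_eq_prod, ← Measure.prod_restrict, Measure.restrict_univ]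
  set V : ℝ≥0∞ := volume (Ioo (-T) (0 : ℝ)) * volume (ball (0 : EuclideanSpace ℝ (Fin 3)) R) with hV
  have hVne : V ≠ ⊤ := ENNReal.mul_ne_top measure_Ioo_lt_top.ne measure_ball_lt_top.ne
  have hvol : ∀ x₀ : EuclideanSpace ℝ (Fin 3), volume (Ioo (-T) 0 ×ˢ ball x₀ R) = V := fun x₀ => by
    rw [Measure.volume_eq_prod, Measure.prod_prod, Measure.addHaar_ball_center volume x₀ R]
  have hbox_sub : ∀ x₀ : EuclideanSpace ℝ (Fin 3), Ioo (-T) 0 ×ˢ ball x₀ R ⊆ S := fun x₀ =>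
    prod_mono Subset.rfl (subset_univ _)
  -- ## a strongly measurable representative on the slab and its slices
  set v : ℝ × EuclideanSpace ℝ (Fin 3) → EuclideanSpace ℝ (Fin 3) := hwm.mk (uncurry w) with hv
  have hvm : StronglyMeasurable v := hwm.stronglyMeasurable_mk
  have hwv : uncurry w =ᵐ[volume.restrict S] v := hwm.ae_eq_mk
  have hslice : ∀ᵐ s ∂(volume.restrict (Ioo (-T) 0)),
      (fun x => v (s, x)) =ᵐ[volume] w s := by
    have h1 : ∀ᵐ z ∂((volume.restrict (Ioo (-T) 0)).prod (volume : Measure (EuclideanSpace ℝ (Fin 3)))),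
        uncurry w z = v z := by rw [← hprod]; exact hwv
    filter_upwards [Measure.ae_ae_of_ae_prod h1] with s hs
    filter_upwards [hs] with x hx
    exact hx.symm
  have hweak' : ∀ᵐ s ∂(volume.restrict (Ioo (-T) 0)), eWeakLpPow (fun x => v (s, x)) 3 volume ≤ W := by
    have h2 : ∀ᵐ s ∂(volume.restrict (Ioo (-T) 0)),
        AEStronglyMeasurable (w s) volume ∧ eWeakLpPow (w s) 3 volume ≤ W :=
      ae_restrict_of_ae_restrict_of_subset Ioo_subset_Iio_self hweak
    filter_upwards [hslice, h2] with s hs h2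
    rw [eWeakLpPow_congr_ae hs]
    exact h2.2
  -- ## the threshold form of the claim
  rw [ENNReal.tendsto_nhds_zero]
  intro ε hε
  rcases eq_or_ne ε ⊤ with rfl | hεtop
  · exact Eventually.of_forall fun x₀ => le_top
  have hε2 : 0 < ε / 2 := ENNReal.half_pos hε.ne'
  -- ## the height `γ > 0` with `γ² V ≤ ε/2`
  obtain ⟨γ, hγpos, hγV⟩ : ∃ γ : ℝ, 0 < γ ∧ ENNReal.ofReal (γ ^ 2) * V ≤ ε / 2 := by
    have hc : Tendsto (fun γ : ℝ => ENNReal.ofReal (γ ^ 2) * V) (𝓝 0) (𝓝 0) := by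
      have h1 : Tendsto (fun γ : ℝ => ENNReal.ofReal (γ ^ 2)) (𝓝 0) (𝓝 0) := by
        have h : Tendsto (fun γ : ℝ => ENNReal.ofReal (γ ^ 2)) (𝓝 0)
            (𝓝 (ENNReal.ofReal ((0 : ℝ) ^ 2))) :=
          (ENNReal.continuous_ofReal.tendsto _).comp ((continuous_pow 2).tendsto (0 : ℝ))
        rwa [zero_pow two_ne_zero, ENNReal.ofReal_zero] at h
      have h2 := ENNReal.Tendsto.mul_const h1 (Or.inr hVne)
      rwa [zero_mul] at h2
    have hev : ∀ᶠ γ in 𝓝[>] (0 : ℝ), ENNReal.ofReal (γ ^ 2) * V ≤ ε / 2 ∧ 0 < γ :=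
      ((hc.eventually (Iic_mem_nhds hε2)).filter_mono nhdsWithin_le_nhds).and self_mem_nhdsWithin
    obtain ⟨γ, hγ1, hγ2⟩ := hev.exists
    exact ⟨γ, hγ2, hγ1⟩
  -- ## the high part `F = |v|² 𝟙_{|v|>γ}`: measurable, integrable on the slab
  set A : Set (ℝ × EuclideanSpace ℝ (Fin 3)) := {z | γ < ‖v z‖} with hA
  have hAm : MeasurableSet A := measurableSet_lt measurable_const hvm.measurable.norm
  set F : ℝ × EuclideanSpace ℝ (Fin 3) → ℝ≥0∞ := fun z => ‖A.indicator v z‖ₑ ^ 2 with hF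
  have hFm : Measurable F := ((hvm.measurable.indicator hAm).enorm).pow_const _
  -- slices of `F`
  have hFslice : ∀ s x, F (s, x) = ‖{x | γ < ‖v (s, x)‖}.indicator (fun x => v (s, x)) x‖ₑ ^ 2 := by
    intro s x
    simp only [hF, hA, indicator, mem_setOf_eq]
  have hslice_bound : ∀ᵐ s ∂(volume.restrict (Ioo (-T) 0)),
      ∫⁻ x, F (s, x) ≤ ENNReal.ofReal (3 / γ) * W := by
    filter_upwards [hweak'] with s hs
    have hmeas_s : AEStronglyMeasurable (fun x => v (s, x)) volume :=
      (hvm.comp_measurable measurable_prodMk_left).aestronglyMeasurable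
    have hAs : MeasurableSet {x : EuclideanSpace ℝ (Fin 3) | γ < ‖v (s, x)‖} :=
      measurableSet_lt measurable_const (hvm.measurable.comp measurable_prodMk_left).norm
    have h := MemWeakLp.lintegral_rpow_indicator_lt_norm_le (p := 3) (μ := volume) hmeas_s hAs
      (r := 2) zero_lt_two (by rw [ENNReal.toReal_ofNat]; norm_num) hγpos
    simp only [ENNReal.toReal_ofNat] at h
    have e1 : (3 : ℝ) / (3 - 2) * γ ^ ((2 : ℝ) - 3) = 3 / γ := by
      rw [show ((2 : ℝ) - 3) = -1 by norm_num, Real.rpow_neg_one]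
      field_simp
      ring
    rw [e1] at h
    calc ∫⁻ x, F (s, x) = ∫⁻ x, ‖{x | γ < ‖v (s, x)‖}.indicator (fun x => v (s, x)) x‖ₑ ^ (2 : ℝ) := by
          refine lintegral_congr fun x => ?_
          rw [hFslice, ← ENNReal.rpow_natCast]
          norm_num
      _ ≤ ENNReal.ofReal (3 / γ) * eWeakLpPow (fun x => v (s, x)) 3 volume := h
      _ ≤ ENNReal.ofReal (3 / γ) * W := by gcongr
  have hFint : ∫⁻ z in S, F z ≠ ⊤ := by
    have h1 : ∫⁻ z in S, F z = ∫⁻ s in Ioo (-T) 0, ∫⁻ x, F (s, x) := by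
      rw [hprod, lintegral_prod _ hFm.aemeasurable]
    rw [h1]
    refine (lt_of_le_of_lt (lintegral_mono_ae hslice_bound) ?_).ne
    rw [lintegral_const, Measure.restrict_apply_univ]
    exact ENNReal.mul_lt_top (ENNReal.mul_lt_top ENNReal.ofReal_lt_top hW.lt_top) measure_Ioo_lt_top
  -- ## the far tails of `F` on the slab tend to zero (dominated convergence)
  have htail : Tendsto (fun n : ℕ => ∫⁻ z in S, {z : ℝ × EuclideanSpace ℝ (Fin 3) | (n : ℝ) ≤ ‖z.2‖}.indicator F z)
      atTop (𝓝 0) := by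
    have h := tendsto_lintegral_of_dominated_convergence (μ := volume.restrict S) F
      (F := fun n : ℕ => {z : ℝ × EuclideanSpace ℝ (Fin 3) | (n : ℝ) ≤ ‖z.2‖}.indicator F) (f := 0)
      (fun n => hFm.indicator (measurableSet_le measurable_const measurable_snd.norm))
      (fun n => Eventually.of_forall fun z => indicator_le_self _ _ z) hFint
      (Eventually.of_forall fun z => ?_)
    · simpa using h
    · obtain ⟨n₀, hn₀⟩ := exists_nat_gt ‖z.2‖
      refine tendsto_const_nhds.congr' ?_
      filter_upwards [eventually_ge_atTop n₀] with n hn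
      rw [Pi.zero_apply, indicator_of_notMem]
      simp only [mem_setOf_eq, not_le]
      exact hn₀.trans_le (by exact_mod_cast hn)
  obtain ⟨N, hN⟩ : ∃ N : ℕ, ∫⁻ z in S, {z : ℝ × EuclideanSpace ℝ (Fin 3) | (N : ℝ) ≤ ‖z.2‖}.indicator F z ≤ ε / 2 := by
    obtain ⟨N, hN⟩ := (ENNReal.tendsto_atTop_zero.1 htail) (ε / 2) hε2
    exact ⟨N, hN N le_rfl⟩
  -- ## far-away centres
  have hmem : {x₀ : EuclideanSpace ℝ (Fin 3) | (N : ℝ) + R < ‖x₀‖} ∈ cocompact (EuclideanSpace ℝ (Fin 3)) := by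
    have h := (isCompact_closedBall (0 : EuclideanSpace ℝ (Fin 3)) ((N : ℝ) + R)).compl_mem_cocompact
    refine Filter.mem_of_superset h fun x₀ hx₀ => ?_
    simpa [mem_closedBall, dist_zero_right] using hx₀
  refine Filter.mem_of_superset hmem fun x₀ hx₀ => ?_
  have hx₀' : (N : ℝ) + R < ‖x₀‖ := hx₀
  have hballfar : ball x₀ R ⊆ {x : EuclideanSpace ℝ (Fin 3) | (N : ℝ) ≤ ‖x‖} := by
    intro x hx
    have h1 : dist x x₀ < R := hx
    have h3 : ‖x₀‖ ≤ ‖x‖ + dist x x₀ := by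
      calc ‖x₀‖ = dist x₀ 0 := (dist_zero_right x₀).symm
        _ ≤ dist x₀ x + dist x 0 := dist_triangle _ _ _
        _ = ‖x‖ + dist x x₀ := by rw [dist_zero_right, dist_comm, add_comm]
    show (N : ℝ) ≤ ‖x‖
    linarith
  show ∫⁻ z in Ioo (-T) 0 ×ˢ ball x₀ R, ‖w z.1 z.2‖ₑ ^ 2 ≤ ε
  -- replace `w` by the representative `v` on the box
  have e1 : ∫⁻ z in Ioo (-T) 0 ×ˢ ball x₀ R, ‖w z.1 z.2‖ₑ ^ 2 =
      ∫⁻ z in Ioo (-T) 0 ×ˢ ball x₀ R, ‖v z‖ₑ ^ 2 :=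
    lintegral_congr_ae ((ae_restrict_of_ae_restrict_of_subset (hbox_sub x₀) hwv).mono fun z hz => by
      show ‖w z.1 z.2‖ₑ ^ 2 = ‖v z‖ₑ ^ 2
      rw [← hz]; rfl)
  rw [e1]
  calc ∫⁻ z in Ioo (-T) 0 ×ˢ ball x₀ R, ‖v z‖ₑ ^ 2
      ≤ ∫⁻ z in Ioo (-T) 0 ×ˢ ball x₀ R, (ENNReal.ofReal (γ ^ 2) + F z) :=
        lintegral_mono fun z => enorm_sq_le_add_indicator v γ z
    _ = ENNReal.ofReal (γ ^ 2) * V + ∫⁻ z in Ioo (-T) 0 ×ˢ ball x₀ R, F z := by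
        rw [lintegral_add_left measurable_const, lintegral_const, Measure.restrict_apply_univ, hvol x₀,
          mul_comm]
    _ ≤ ε / 2 + ∫⁻ z in S, {z : ℝ × EuclideanSpace ℝ (Fin 3) | (N : ℝ) ≤ ‖z.2‖}.indicator F z := by
        refine add_le_add hγV ?_
        calc ∫⁻ z in Ioo (-T) 0 ×ˢ ball x₀ R, F z
            = ∫⁻ z in Ioo (-T) 0 ×ˢ ball x₀ R,
                {z : ℝ × EuclideanSpace ℝ (Fin 3) | (N : ℝ) ≤ ‖z.2‖}.indicator F z := by
              refine setLIntegral_congr_fun (measurableSet_Ioo.prod measurableSet_ball) ?_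
              exact fun z hz =>
                (indicator_of_mem (show z ∈ {z : ℝ × EuclideanSpace ℝ (Fin 3) | (N : ℝ) ≤ ‖z.2‖}
                  from hballfar (mem_prod.1 hz).2) F).symm
          _ ≤ ∫⁻ z in S, {z : ℝ × EuclideanSpace ℝ (Fin 3) | (N : ℝ) ≤ ‖z.2‖}.indicator F z :=
              lintegral_mono_set (hbox_sub x₀)
    _ ≤ ε / 2 + ε / 2 := add_le_add le_rfl hN
    _ = ε := ENNReal.add_halves ε

/-! ### The restart of the ancient solution with weak-`L³` slices -/

/-- **The local energy ancient solution with weak-`L³` slices, restarted at almost every time, is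
a local Leray solution on a slab vanishing at the final time** (the weak-`L³` twin of
`ESSBlowup.exists_restart`; the object of Seregin 2019, §4, p. 8: "a local energy ancient
solution `w` with … `‖w‖_{L_∞(-∞,0;L^{3,∞}(ℝ³))} ≤ M`; `w(x,0) = 0`", put in the class of
Lemarié-Rieusset 2016, Thm. 15.4 as on p. 568 there: "for almost every `T₃`, `u` is a local Leray
solution on `(T₃, T₁)`"). Let `(w, π)` be a suitable weak solution in every `Q(a)` with
`w ∈ L³(Q(a))`, whose slices `w(s)` are a.e.-strongly measurable and weak-`L³` with
`sup_t t³|{|w(s)| > t}| ≤ W < ∞` for a.e. `s < 0`, which has a weak spatial gradient on the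
half-space `]-∞,0[ × ℝ³` with uniformly local dissipation on the boxes `]-T,0[ × B(x₀,R)`, and
whose pairings with test fields vanish essentially as `s ↑ 0`. Then for every `T > 0` there are
`s₀ ∈ ]-T, -T/2[` and `W : ℝ → ℝ³ → ℝ³` such that `(W, π(s₀ + ·))` is a local Leray solution on
`(0, -s₀) × ℝ³` with datum `w(s₀)` (`IsLocalLeraySolutionOn`), `w(s₀)` is weakly divergence
free, `∫ ⟪W(t), φ⟫ → 0` as `t ↑ -s₀` for every test field `φ`, and `W = 0` a.e. on the strip
forces `w = 0` a.e. on `]s₀, 0[ × ℝ³`. The proof is that of `ESSBlowup.exists_restart` with the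
weak-`L³` inputs of this file.
[cite: Seregin2019, §4 p. 8 (properties of the ancient solution w)] [cite: LemarieRieusset2016, Thm. 15.4 and proof p. 568] -/
theorem exists_restart_weakL3 {W : ℝ≥0∞} (hW : W ≠ ∞)
    (hw : ∀ a : ℝ, 0 < a → IsSuitableWeakSolutionInBall a (0 : ℝ × EuclideanSpace ℝ (Fin 3)) w π)
    (hw3 : ∀ a : ℝ, 0 < a → MemLp (uncurry w) 3
      (volume.restrict (parabolicCylinder a (0 : ℝ × EuclideanSpace ℝ (Fin 3)))))
    (hweak : ∀ᵐ s ∂(volume.restrict (Iio (0 : ℝ))),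
      AEStronglyMeasurable (w s) volume ∧ eWeakLpPow (w s) 3 volume ≤ W)
    (hG : ∃ G : ℝ → EuclideanSpace ℝ (Fin 3) → EuclideanSpace ℝ (Fin 3) →L[ℝ] EuclideanSpace ℝ (Fin 3),
      HasWeakSpatialGradientOn (slab (EuclideanSpace ℝ (Fin 3)) (Iio 0) isOpen_Iio) w G ∧
      ∀ T : ℝ, 0 < T → ∀ R : ℝ, 0 < R → ∃ C : ℝ≥0∞, C ≠ ∞ ∧ ∀ x₀ : EuclideanSpace ℝ (Fin 3),
        ∫⁻ z in Ioo (-T) 0 ×ˢ ball x₀ R, ENNReal.ofReal (frobeniusNormSq (G z.1 z.2)) ≤ C)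
    (htop : ∀ φ : EuclideanSpace ℝ (Fin 3) → EuclideanSpace ℝ (Fin 3), ContDiff ℝ (⊤ : ℕ∞) φ →
      HasCompactSupport φ → ∀ ε : ℝ, 0 < ε → ∃ s₁ : ℝ, s₁ < 0 ∧
        ∀ᵐ s ∂(volume.restrict (Ioo s₁ 0)), |∫ y, ⟪w s y, φ y⟫| ≤ ε)
    {T : ℝ} (hT : 0 < T) :
    ∃ s₀ ∈ Ioo (-T) (-T / 2), ∃ W' : ℝ → EuclideanSpace ℝ (Fin 3) → EuclideanSpace ℝ (Fin 3),
      IsLocalLeraySolutionOn (-s₀) 1 (w s₀) W' (fun t x => π (s₀ + t) x) ∧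
      IsWeaklyDivFree (w s₀) ∧
      (∀ φ : EuclideanSpace ℝ (Fin 3) → EuclideanSpace ℝ (Fin 3),
        FunctionSpaces.IsTestFunctionOn (⊤ : Opens (EuclideanSpace ℝ (Fin 3))) φ →
          Tendsto (fun t => ∫ x, ⟪W' t x, φ x⟫) (𝓝[<] (-s₀)) (𝓝 0)) ∧
      ((∀ᵐ z ∂(volume.restrict (Ioo 0 (-s₀) ×ˢ (univ : Set (EuclideanSpace ℝ (Fin 3))))),
          W' z.1 z.2 = 0) →
        ∀ᵐ z ∂(volume.restrict (Ioo s₀ 0 ×ˢ (univ : Set (EuclideanSpace ℝ (Fin 3))))),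
          w z.1 z.2 = 0) := by
  classical
  -- ## Step 0: the half-space solution and the good time `s₀`
  have hslab := ESSBlowup.isSuitableWeakSolutionOn_halfspace hw
  have hu3 := ESSBlowup.locallyIntegrableOn_cube_halfspace hw3
  have hab : Ioo (-(T + 1)) 0 ×ˢ (univ : Set (EuclideanSpace ℝ (Fin 3))) ⊆
      (slab (EuclideanSpace ℝ (Fin 3)) (Iio 0) isOpen_Iio : Set _) := fun z hz =>
    mem_slab.2 (mem_prod.1 hz).1.2
  have hRC := SuitableRestart.ae_tendsto_lintegral_ball_sub_sq hslab hu3 hab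
  have hDF := SuitableRestart.ae_isWeaklyDivFree_slice hslab hab
  have hWk : ∀ᵐ s ∂(volume : Measure ℝ), s < 0 →
      AEStronglyMeasurable (w s) volume ∧ eWeakLpPow (w s) 3 volume ≤ W :=
    (ae_restrict_iff' measurableSet_Iio).1 hweak
  obtain ⟨s₀, hs₀I, hs₀RC, hs₀DF⟩ : ∃ s₀ ∈ Ioo (-T) (-T / 2),
      (s₀ ∈ Ioo (-(T + 1)) 0 → ∃ S : Set ℝ, (∀ᵐ t ∂(volume : Measure ℝ), t ∈ S) ∧
        ∀ r : ℝ, Tendsto (fun t => ∫⁻ x in ball (0 : EuclideanSpace ℝ (Fin 3)) r,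
          ‖w t x - w s₀ x‖ₑ ^ 2) (𝓝[Ioi s₀ ∩ S] s₀) (𝓝 0)) ∧
      (s₀ ∈ Ioo (-(T + 1)) 0 → IsWeaklyDivFree (w s₀)) := by
    obtain ⟨s₀, hs₀, h1⟩ := exists_mem_Ioo_of_ae (hRC.and hDF) (by linarith : -T < -T / 2)
    exact ⟨s₀, hs₀, h1.1, h1.2⟩
  have hs₀neg : s₀ < 0 := by linarith [hs₀I.2]
  have hs₀T : -T < s₀ := hs₀I.1
  have hs₀I' : s₀ ∈ Ioo (-(T + 1)) 0 := ⟨by linarith, hs₀neg⟩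
  obtain ⟨S, hSae, hS⟩ := hs₀RC hs₀I'
  have hdiv := hs₀DF hs₀I'
  set T₁ : ℝ := -s₀ with hT₁
  have hT₁pos : 0 < T₁ := by rw [hT₁]; linarith
  -- ## Step 1: the good set of times `𝒢 ⊆ S`
  set Gset : Set ℝ := {s | s < 0 → AEStronglyMeasurable (w s) volume ∧ eWeakLpPow (w s) 3 volume ≤ W}
    with hGset
  have hGae : ∀ᵐ s ∂(volume : Measure ℝ), s ∈ Gset := hWk
  choose ψ hψ hψd using fun m : ℕ => exists_dense_seq_isTestFunctionOn ((m : ℝ) + 1)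
  have hψs : ∀ m i, ContDiff ℝ (⊤ : ℕ∞) (ψ m i) := fun m i => (hψ m i).contDiff
  have hψc : ∀ m i, HasCompactSupport (ψ m i) := fun m i => (hψ m i).hasCompactSupport
  choose s₁ hs₁ hs₁ae using fun m i j : ℕ =>
    htop (ψ m i) (hψs m i) (hψc m i) (1 / ((j : ℝ) + 1)) (by positivity)
  set Vset : ℕ → ℕ → ℕ → Set ℝ := fun m i j =>
    {s | s ∈ Ioo (s₁ m i j) 0 → |∫ y, ⟪w s y, ψ m i y⟫| ≤ 1 / ((j : ℝ) + 1)} with hVset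
  have hVae : ∀ m i j, ∀ᵐ s ∂(volume : Measure ℝ), s ∈ Vset m i j := fun m i j =>
    (ae_restrict_iff' measurableSet_Ioo).1 (hs₁ae m i j)
  set 𝒢 : Set ℝ := S ∩ Gset ∩ {s | ∀ m i j, s ∈ Vset m i j} with h𝒢
  have h𝒢ae : ∀ᵐ s ∂(volume : Measure ℝ), s ∈ 𝒢 := by
    have h3 : ∀ᵐ s ∂(volume : Measure ℝ), ∀ m i j, s ∈ Vset m i j :=
      ae_all_iff.2 fun m => ae_all_iff.2 fun i => ae_all_iff.2 fun j => hVae m i j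
    filter_upwards [hSae, hGae, h3] with s h1 h2 h3
    exact ⟨⟨h1, h2⟩, h3⟩
  have h𝒢S : 𝒢 ⊆ S := fun s hs => hs.1.1
  -- good shifted times, a.e. in time and in space–time
  have hshift_ae : ∀ {P : ℝ → Prop}, (∀ᵐ s ∂(volume : Measure ℝ), P s) →
      ∀ᵐ t ∂(volume : Measure ℝ), P (s₀ + t) := fun h =>
    (measurePreserving_add_left volume s₀).quasiMeasurePreserving.ae h
  have hgood_t : ∀ᵐ t ∂(volume : Measure ℝ), s₀ + t ∈ 𝒢 := hshift_ae h𝒢ae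
  have hgood_z : ∀ᵐ z ∂(volume : Measure (ℝ × EuclideanSpace ℝ (Fin 3))), s₀ + z.1 ∈ 𝒢 := by
    rw [Measure.volume_eq_prod]
    exact Measure.quasiMeasurePreserving_fst.ae hgood_t
  -- ## Step 2: the representative
  set W' : ℝ → EuclideanSpace ℝ (Fin 3) → EuclideanSpace ℝ (Fin 3) := fun t x =>
    if s₀ + t ∈ 𝒢 then w (s₀ + t) x else if t ≤ T₁ / 2 then w s₀ x else 0 with hW'
  have hWgood : ∀ t, s₀ + t ∈ 𝒢 → W' t = w (s₀ + t) := fun t ht => by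
    funext x; simp only [hW', if_pos ht]
  have hWbad₁ : ∀ t, s₀ + t ∉ 𝒢 → t ≤ T₁ / 2 → W' t = w s₀ := fun t ht ht' => by
    funext x; simp only [hW', if_neg ht, if_pos ht']
  have hWbad₂ : ∀ t, s₀ + t ∉ 𝒢 → ¬t ≤ T₁ / 2 → W' t = 0 := fun t ht ht' => by
    funext x; simp only [hW', if_neg ht, if_neg ht', Pi.zero_apply]
  have hWae : ∀ᵐ z ∂(volume : Measure (ℝ × EuclideanSpace ℝ (Fin 3))),
      W' z.1 z.2 = w (s₀ + z.1) z.2 := by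
    filter_upwards [hgood_z] with z hz
    rw [hWgood z.1 hz]
  -- ## Step 3: the translated suitable solution and its weak gradient
  have hsub0 : (slab (EuclideanSpace ℝ (Fin 3)) (Ioo s₀ 0) isOpen_Ioo) ≤
      slab (EuclideanSpace ℝ (Fin 3)) (Iio 0) isOpen_Iio := slab_mono Ioo_subset_Iio_self
  have hshift : IsSuitableWeakSolutionOn (slab (EuclideanSpace ℝ (Fin 3)) (Ioo 0 T₁) isOpen_Ioo) 1 0
      (fun s y => w (s₀ + s) y) (fun s y => π (s₀ + s) y) := by
    have h := (hslab.of_le hsub0).timeShift s₀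
    rwa [sub_self, zero_sub] at h
  have hWsuit : IsSuitableWeakSolutionOn (slab (EuclideanSpace ℝ (Fin 3)) (Ioo 0 T₁) isOpen_Ioo) 1 0
      W' (fun s y => π (s₀ + s) y) :=
    hshift.congr_ae (ae_restrict_of_ae (hWae.mono fun z hz => hz.symm))
      (Eventually.of_forall fun _ => rfl)
  obtain ⟨G₀, hG₀, hG₀b⟩ := hG
  have hGshift : HasWeakSpatialGradientOn (slab (EuclideanSpace ℝ (Fin 3)) (Ioo 0 T₁) isOpen_Ioo)
      (fun s y => w (s₀ + s) y) (fun s y => G₀ (s₀ + s) y) := by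
    have h := (hG₀.mono hsub0).timeShift s₀
    rwa [sub_self, zero_sub] at h
  have hWG : HasWeakSpatialGradientOn (slab (EuclideanSpace ℝ (Fin 3)) (Ioo 0 T₁) isOpen_Ioo)
      W' (fun s y => G₀ (s₀ + s) y) :=
    hGshift.congr_ae (ae_restrict_of_ae (hWae.mono fun z hz => hz.symm))
  -- time translation of lower integrals over boxes: `∫_{(0,T₁)×K} F(s₀+t, x) = ∫_{(s₀,0)×K} F`
  have hshiftInt : ∀ (K : Set (EuclideanSpace ℝ (Fin 3))) (F : ℝ × EuclideanSpace ℝ (Fin 3) → ℝ≥0∞),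
      ∫⁻ z in Ioo 0 T₁ ×ˢ K, F (s₀ + z.1, z.2) = ∫⁻ z in Ioo s₀ 0 ×ˢ K, F z := by
    intro K F
    have h := setLIntegral_prod_timeShift s₀ s₀ 0 K F
    rwa [sub_self, zero_sub] at h
  -- the a.e. equality `W' = w(s₀ + ·)` in `‖·‖ₑ²` form on restricted measures
  have hWae_sq : ∀ (A : Set (ℝ × EuclideanSpace ℝ (Fin 3))),
      ∫⁻ z in A, ‖W' z.1 z.2‖ₑ ^ 2 = ∫⁻ z in A, ‖w (s₀ + z.1) z.2‖ₑ ^ 2 := fun A =>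
    lintegral_congr_ae ((ae_restrict_of_ae hWae).mono fun z hz => by
      show ‖W' z.1 z.2‖ₑ ^ 2 = ‖w (s₀ + z.1) z.2‖ₑ ^ 2
      rw [hz])
  -- measurability of `w` on the slabs `]-T', 0[ × ℝ³`
  have hwm : ∀ T' : ℝ, 0 < T' → AEStronglyMeasurable (uncurry w)
      (volume.restrict (Ioo (-T') 0 ×ˢ (univ : Set (EuclideanSpace ℝ (Fin 3))))) := fun T' hT' =>
    aestronglyMeasurable_slab_of_forall_cylinder
      (fun a ha => (hw a ha).1.distributional.1.aestronglyMeasurable) hT'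
  -- ## Step 4: the local Leray structure
  have hLL : IsLocalLeraySolutionOn T₁ 1 (w s₀) W' (fun t x => π (s₀ + t) x) := by
    refine ⟨hWsuit, fun K hK => ?_, fun K hK => ?_, fun R hR => ?_, ⟨_, hWG, fun R hR => ?_⟩,
      fun K hK => ?_, fun R hR => ?_⟩
    · -- `W' ∈ L²((0,T₁) × K)`
      have e : ∫⁻ z in Ioo 0 T₁ ×ˢ K, ‖w (s₀ + z.1) z.2‖ₑ ^ 2 = ∫⁻ z in Ioo s₀ 0 ×ˢ K, ‖w z.1 z.2‖ₑ ^ 2 :=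
        hshiftInt K (fun z => ‖w z.1 z.2‖ₑ ^ 2)
      rw [hWae_sq, e]
      have h := lintegral_box_sq_lt_top hw3 T₁ hK.isBounded
      rwa [hT₁, neg_neg] at h
    · -- `π ∈ L^{3/2}((0,T₁) × K)`
      have e : ∫⁻ z in Ioo 0 T₁ ×ˢ K, ‖π (s₀ + z.1) z.2‖ₑ ^ (3 / 2 : ℝ) =
          ∫⁻ z in Ioo s₀ 0 ×ˢ K, ‖π z.1 z.2‖ₑ ^ (3 / 2 : ℝ) :=
        hshiftInt K (fun z => ‖π z.1 z.2‖ₑ ^ (3 / 2 : ℝ))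
      show ∫⁻ z in Ioo 0 T₁ ×ˢ K, ‖π (s₀ + z.1) z.2‖ₑ ^ (3 / 2 : ℝ) < ⊤
      rw [e]
      have h := lintegral_box_pressure_lt_top hw T₁ hK.isBounded
      rwa [hT₁, neg_neg] at h
    · -- uniformly local energy, a.e. in time
      obtain ⟨C, hC, hCae⟩ := exists_ae_forall_lintegral_ball_sq_le_weakL3 hW hweak R
      refine ⟨C.toNNReal, ?_⟩
      have h1 : ∀ᵐ t ∂(volume : Measure ℝ), s₀ + t < 0 →
          ∀ x₀ : EuclideanSpace ℝ (Fin 3), ∫⁻ x in ball x₀ R, ‖w (s₀ + t) x‖ₑ ^ 2 ≤ C :=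
        hshift_ae ((ae_restrict_iff' measurableSet_Iio).1 hCae)
      refine (ae_restrict_iff' measurableSet_Ioo).2 ?_
      filter_upwards [h1, hgood_t] with t ht htg htI x₀
      rw [hWgood t htg, ENNReal.coe_toNNReal hC]
      exact ht (by rw [hT₁] at htI; linarith [htI.2]) x₀
    · -- uniformly local dissipation
      obtain ⟨C, hC, hCb⟩ := hG₀b T hT R hR
      refine ⟨C.toNNReal, fun x₀ => ?_⟩
      have e : ∫⁻ z in Ioo 0 T₁ ×ˢ ball x₀ R, ENNReal.ofReal (frobeniusNormSq (G₀ (s₀ + z.1) z.2)) =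
          ∫⁻ z in Ioo s₀ 0 ×ˢ ball x₀ R, ENNReal.ofReal (frobeniusNormSq (G₀ z.1 z.2)) :=
        hshiftInt (ball x₀ R) (fun z => ENNReal.ofReal (frobeniusNormSq (G₀ z.1 z.2)))
      show ∫⁻ z in Ioo 0 T₁ ×ˢ ball x₀ R, ENNReal.ofReal (frobeniusNormSq (G₀ (s₀ + z.1) z.2)) ≤ C.toNNReal
      rw [ENNReal.coe_toNNReal hC, e]
      exact (lintegral_mono_set (prod_mono (Ioo_subset_Ioo hs₀T.le le_rfl) Subset.rfl)).trans (hCb x₀)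
    · -- the datum is attained strongly in `L²(K)`
      obtain ⟨r, hr⟩ := hK.isBounded.subset_ball (0 : EuclideanSpace ℝ (Fin 3))
      have hSr := hS r
      rw [ENNReal.tendsto_nhds_zero]
      intro ε hε
      have h1 : ∀ᶠ τ in 𝓝 s₀, τ ∈ Ioi s₀ ∩ S →
          ∫⁻ x in ball (0 : EuclideanSpace ℝ (Fin 3)) r, ‖w τ x - w s₀ x‖ₑ ^ 2 ≤ ε :=
        eventually_nhdsWithin_iff.1 ((ENNReal.tendsto_nhds_zero.1 hSr) ε hε)
      have hcont : Tendsto (fun t : ℝ => s₀ + t) (𝓝 0) (𝓝 s₀) := by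
        have h := (continuous_const_add s₀).tendsto (0 : ℝ)
        rwa [add_zero] at h
      have h2 : ∀ᶠ t in 𝓝 (0 : ℝ), s₀ + t ∈ Ioi s₀ ∩ S →
          ∫⁻ x in ball (0 : EuclideanSpace ℝ (Fin 3)) r, ‖w (s₀ + t) x - w s₀ x‖ₑ ^ 2 ≤ ε :=
        hcont.eventually h1
      have h3 : ∀ᶠ t in 𝓝 (0 : ℝ), t ≤ T₁ / 2 := Iic_mem_nhds (by positivity)
      refine eventually_nhdsWithin_iff.2 ?_
      filter_upwards [h2, h3] with t h2 h3 ht0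
      by_cases htg : s₀ + t ∈ 𝒢
      · rw [hWgood t htg]
        exact (lintegral_mono_set hr).trans (h2 ⟨by show s₀ < s₀ + t; linarith [mem_Ioi.1 ht0], h𝒢S htg⟩)
      · rw [hWbad₁ t htg h3]
        simp
    · -- decay at spatial infinity, from the weak-`L³` slices
      have h := tendsto_lintegral_box_sq_cocompact_weakL3 hW (hwm T₁ hT₁pos) hweak R
      rw [hT₁, neg_neg] at h
      refine h.congr fun x₀ => ?_
      have e : ∫⁻ z in Ioo 0 T₁ ×ˢ ball x₀ R, ‖w (s₀ + z.1) z.2‖ₑ ^ 2 =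
          ∫⁻ z in Ioo s₀ 0 ×ˢ ball x₀ R, ‖w z.1 z.2‖ₑ ^ 2 :=
        hshiftInt (ball x₀ R) (fun z => ‖w z.1 z.2‖ₑ ^ 2)
      rw [hWae_sq, e]
  refine ⟨s₀, hs₀I, W', hLL, hdiv, fun φ hφ => ?_, fun hzero => ?_⟩
  · -- ## Step 5: the pairings vanish at the final time
    -- a ball `B = B(0, m+1)` carrying the support of `φ`
    obtain ⟨r, hr⟩ := hφ.hasCompactSupport.isCompact.isBounded.subset_closedBall (0 : EuclideanSpace ℝ (Fin 3))
    obtain ⟨m, hm⟩ := exists_nat_ge r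
    set B : Set (EuclideanSpace ℝ (Fin 3)) := ball (0 : EuclideanSpace ℝ (Fin 3)) ((m : ℝ) + 1) with hB
    have hφB : tsupport φ ⊆ B := hr.trans (closedBall_subset_ball (by linarith))
    have hφ0 : ∀ x ∉ B, φ x = 0 := fun x hx => image_eq_zero_of_notMem_tsupport fun h => hx (hφB h)
    have hψ0 : ∀ i, ∀ x ∉ B, ψ m i x = 0 := fun i x hx =>
      image_eq_zero_of_notMem_tsupport fun h => hx ((hψ m i).tsupport_subset h)
    have hφ2 : MemLp φ 2 (volume.restrict B) :=
      (hφ.contDiff.continuous.memLp_of_hasCompactSupport hφ.hasCompactSupport).restrict B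
    have hψ2 : ∀ i, MemLp (ψ m i) 2 (volume.restrict B) := fun i =>
      ((hψ m i).contDiff.continuous.memLp_of_hasCompactSupport (hψ m i).hasCompactSupport).restrict B
    -- the `L²(B)` bound of good slices (`L^{3,∞} ⊂ L²_loc`)
    set Λ : ℝ≥0∞ := volume B + 2 * W with hΛ
    have hΛfin : Λ ≠ ⊤ := ENNReal.add_ne_top.2 ⟨measure_ball_lt_top.ne, ENNReal.mul_ne_top (by norm_num) hW⟩
    set Cm : ℝ := (Λ ^ (1 / 2 : ℝ)).toReal with hCm
    have hCm0 : 0 ≤ Cm := ENNReal.toReal_nonneg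
    have hgoodL2 : ∀ s ∈ 𝒢, s < 0 → MemLp (w s) 2 (volume.restrict B) ∧
        (eLpNorm (w s) 2 (volume.restrict B)).toReal ≤ Cm := by
      intro s hs hs0
      obtain ⟨hms, hle⟩ := hs.1.2 hs0
      have hsq : ∫⁻ x in B, ‖w s x‖ₑ ^ 2 ≤ Λ := by
        refine (MemWeakLp.setLIntegral_enorm_sq_le_of_three hms B).trans ?_
        rw [hΛ]
        gcongr
      have hmem : MemLp (w s) 2 (volume.restrict B) :=
        memLp_two_restrict_of_lintegral_lt_top hms (hsq.trans_lt hΛfin.lt_top)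
      refine ⟨hmem, ?_⟩
      rw [hCm, FunctionSpaces.AubinLions.eLpNorm_two_eq_rpow]
      exact ENNReal.toReal_mono (ENNReal.rpow_ne_top_of_nonneg (by norm_num) hΛfin)
        (ENNReal.rpow_le_rpow hsq (by norm_num))
    -- whole-space pairings of fields vanishing off `B` are pairings on `B`
    have hpairB : ∀ {v g : EuclideanSpace ℝ (Fin 3) → EuclideanSpace ℝ (Fin 3)},
        (∀ x ∉ B, g x = 0) → ∫ y, ⟪v y, g y⟫ = ∫ y in B, ⟪v y, g y⟫ := by
      intro v g hg
      exact (setIntegral_eq_integral_of_forall_compl_eq_zero fun x hx => by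
        rw [hg x hx, inner_zero_right]).symm
    rw [Metric.tendsto_nhds]
    intro ε hε
    -- the approximating test field `ψ m i` and the accuracy index `j`
    set δ : ℝ := ε / (4 * (Cm + 1)) with hδ
    have hδpos : 0 < δ := by positivity
    obtain ⟨i, hi⟩ := hψd m φ hφ2 (ENNReal.ofReal δ) (ENNReal.ofReal_pos.2 hδpos).ne'
    have hi' : (eLpNorm (φ - ψ m i) 2 (volume.restrict B)).toReal ≤ δ := ENNReal.toReal_le_of_le_ofReal hδpos.le hi
    obtain ⟨j, hj⟩ := exists_nat_one_div_lt (half_pos hε)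
    -- eventually: `t > T₁/2`, `t < T₁`, `s₀ + t > s₁`
    have hτ : s₁ m i j - s₀ < T₁ := by rw [hT₁]; linarith [hs₁ m i j]
    have h1 : ∀ᶠ t in 𝓝[<] T₁, T₁ / 2 < t := mem_nhdsWithin_of_mem_nhds (Ioi_mem_nhds (by linarith))
    have h2 : ∀ᶠ t in 𝓝[<] T₁, s₁ m i j - s₀ < t := mem_nhdsWithin_of_mem_nhds (Ioi_mem_nhds hτ)
    have h3 : ∀ᶠ t in 𝓝[<] T₁, t < T₁ := self_mem_nhdsWithin
    filter_upwards [h1, h2, h3] with t ht1 ht2 ht3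
    rw [Real.dist_eq, sub_zero]
    by_cases htg : s₀ + t ∈ 𝒢
    · -- good time: `W' t = w(s₀ + t)`
      rw [hWgood t htg]
      set s : ℝ := s₀ + t with hs
      have hs0 : s < 0 := by rw [hs]; linarith
      have hsI : s ∈ Ioo (s₁ m i j) 0 := ⟨by rw [hs]; linarith, hs0⟩
      obtain ⟨hv2, hvb⟩ := hgoodL2 s htg hs0
      have hV : |∫ y, ⟪w s y, ψ m i y⟫| ≤ 1 / ((j : ℝ) + 1) := htg.2 m i j hsI
      -- split `φ = ψ + (φ - ψ)` on `B`
      have hI1 : Integrable (fun y => ⟪w s y, φ y⟫) (volume.restrict B) := integrable_real_inner_of_memLp_two hv2 hφ2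
      have hI2 : Integrable (fun y => ⟪w s y, ψ m i y⟫) (volume.restrict B) := integrable_real_inner_of_memLp_two hv2 (hψ2 i)
      have e1 : ∫ y, ⟪w s y, φ y⟫ = (∫ y in B, ⟪w s y, ψ m i y⟫) + ∫ y in B, ⟪w s y, φ y - ψ m i y⟫ := by
        rw [hpairB hφ0, ← integral_add hI2 (hI1.sub hI2 |>.congr (Eventually.of_forall fun y => by
          simp only [Pi.sub_apply, inner_sub_right]))]
        refine integral_congr_ae (Eventually.of_forall fun y => ?_)
        simp only [inner_sub_right]
        ring
      have e2 : ∫ y, ⟪w s y, ψ m i y⟫ = ∫ y in B, ⟪w s y, ψ m i y⟫ := hpairB (hψ0 i)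
      have hCS : |∫ y in B, ⟪w s y, φ y - ψ m i y⟫| ≤ Cm * δ := by
        refine (abs_integral_inner_le_of_memLp_two hv2 (hφ2.sub (hψ2 i))).trans ?_
        exact mul_le_mul hvb hi' ENNReal.toReal_nonneg hCm0
      have hCmδ : Cm * δ ≤ ε / 4 := by
        rw [hδ, mul_div_assoc', div_le_div_iff₀ (by positivity) (by positivity)]
        nlinarith
      rw [e1, ← e2]
      calc |(∫ y, ⟪w s y, ψ m i y⟫) + ∫ y in B, ⟪w s y, φ y - ψ m i y⟫|
          ≤ |∫ y, ⟪w s y, ψ m i y⟫| + |∫ y in B, ⟪w s y, φ y - ψ m i y⟫| := abs_add_le _ _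
        _ ≤ 1 / ((j : ℝ) + 1) + ε / 4 := add_le_add hV (hCS.trans hCmδ)
        _ < ε := by linarith
    · -- exceptional time in the second half: `W' t = 0`
      rw [hWbad₂ t htg (not_le.2 ht1)]
      simpa using hε
  · -- ## Step 6: `W' = 0` a.e. on the strip forces `w = 0` a.e. on `]s₀, 0[ × ℝ³`
    have h1 : ∀ᵐ z ∂(volume.restrict (Ioo 0 T₁ ×ˢ (univ : Set (EuclideanSpace ℝ (Fin 3))))),
        w (s₀ + z.1) z.2 = 0 := by
      filter_upwards [hzero, ae_restrict_of_ae hWae] with z hz hz'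
      rw [← hz', hz]
    have hmp := measurePreserving_timeShift_restrict (E := EuclideanSpace ℝ (Fin 3)) (-s₀) s₀ 0
      (univ : Set (EuclideanSpace ℝ (Fin 3)))
    rw [add_neg_cancel, zero_add] at hmp
    have h2 := hmp.quasiMeasurePreserving.ae h1
    filter_upwards [h2] with z hz
    have hz' : w (s₀ + (z.1 + -s₀)) z.2 = 0 := hz
    have e : s₀ + (z.1 + -s₀) = z.1 := by ring
    rwa [e] at hz'

/-! ### The Liouville theorem (Seregin 2019, §4: `w ≡ 0`) -/

/-- **The endgame of Seregin 2019, §4: a local energy ancient solution with weak-`L³` slices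
which vanishes at the final time is identically zero** ("using arguments of the paper [ESS2003],
we show that `w ≡ 0` in `ℝ³ × ]-1, 0[`", p. 8). Let `(w, π)` be a suitable weak solution in every
parabolic ball `Q(a)`, `a > 0`, with `w ∈ L³(Q(a))`, slices `w(s)` a.e.-strongly measurable and
weak-`L³` with `sup_t t³ |{|w(s)| > t}| ≤ W < ∞` for a.e. `s < 0`
(`‖w‖_{L_∞(-∞,0;L^{3,∞}(ℝ³))} ≤ M`), a weak spatial gradient on `]-∞,0[ × ℝ³` with uniformly
local dissipation on boxes (print: `E(w, ϱ; z₀) ≤ Θ ≤ c(M,N)` for all `ϱ > 0`, `z₀ ∈ Q₋`), and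
pairings `∫ ⟪w(s), φ⟫` with test fields vanishing essentially as `s ↑ 0` (print: `w(x,0) = 0`).
Then `w = 0` a.e. on `]-T, 0[ × ℝ³` for every `T > 0`. Proof: `exists_restart_weakL3` at a good
time `s₀ < -T` and Lemarié-Rieusset's Thm. 15.4 in its any-datum form
(`IsLocalLeraySolutionOn.ae_zero_of_final_vanishing_anyDatum`: CWY/LR far-field regularity, ESS
backward uniqueness and unique continuation).
[cite: Seregin2019, §4 p. 8 (w ≡ 0 by [ESS2003])] [cite: LemarieRieusset2016, Thm. 15.4] [cite: EscauriazaSereginSverak2003, §5] -/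
theorem ae_zero_of_weakL3_ancient_top_vanishing {W : ℝ≥0∞} (hW : W ≠ ∞)
    (hw : ∀ a : ℝ, 0 < a → IsSuitableWeakSolutionInBall a (0 : ℝ × EuclideanSpace ℝ (Fin 3)) w π)
    (hw3 : ∀ a : ℝ, 0 < a → MemLp (uncurry w) 3
      (volume.restrict (parabolicCylinder a (0 : ℝ × EuclideanSpace ℝ (Fin 3)))))
    (hweak : ∀ᵐ s ∂(volume.restrict (Iio (0 : ℝ))),
      AEStronglyMeasurable (w s) volume ∧ eWeakLpPow (w s) 3 volume ≤ W)
    (hG : ∃ G : ℝ → EuclideanSpace ℝ (Fin 3) → EuclideanSpace ℝ (Fin 3) →L[ℝ] EuclideanSpace ℝ (Fin 3),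
      HasWeakSpatialGradientOn (slab (EuclideanSpace ℝ (Fin 3)) (Iio 0) isOpen_Iio) w G ∧
      ∀ T : ℝ, 0 < T → ∀ R : ℝ, 0 < R → ∃ C : ℝ≥0∞, C ≠ ∞ ∧ ∀ x₀ : EuclideanSpace ℝ (Fin 3),
        ∫⁻ z in Ioo (-T) 0 ×ˢ ball x₀ R, ENNReal.ofReal (frobeniusNormSq (G z.1 z.2)) ≤ C)
    (htop : ∀ φ : EuclideanSpace ℝ (Fin 3) → EuclideanSpace ℝ (Fin 3), ContDiff ℝ (⊤ : ℕ∞) φ →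
      HasCompactSupport φ → ∀ ε : ℝ, 0 < ε → ∃ s₁ : ℝ, s₁ < 0 ∧
        ∀ᵐ s ∂(volume.restrict (Ioo s₁ 0)), |∫ y, ⟪w s y, φ y⟫| ≤ ε)
    {T : ℝ} (hT : 0 < T) :
    ∀ᵐ z ∂(volume.restrict (Ioo (-T) 0 ×ˢ (univ : Set (EuclideanSpace ℝ (Fin 3))))),
      w z.1 z.2 = 0 := by
  -- restart at a good time `s₀ ∈ ]-2T, -T[`
  obtain ⟨s₀, hs₀, W', hLL, hdiv, hfinal, htransfer⟩ :=
    exists_restart_weakL3 hW hw hw3 hweak hG htop (by positivity : (0 : ℝ) < 2 * T)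
  have hs₀T : s₀ < -T := by linarith [hs₀.2]
  have hT₁ : 0 < -s₀ := by linarith
  -- backward uniqueness for the restarted local Leray solution (any datum)
  have hzero := IsLocalLeraySolutionOn.ae_zero_of_final_vanishing_anyDatum one_pos hT₁ hdiv hLL hfinal
  have hwz := htransfer hzero
  exact ae_restrict_of_ae_restrict_of_subset (prod_mono (Ioo_subset_Ioo hs₀T.le le_rfl) Subset.rfl) hwz

/-- **The contradiction form**: under the hypotheses of `ae_zero_of_weakL3_ancient_top_vanishing`,
`∫_{Q(a)} |w|³ = 0` for every `a > 0` — incompatible with the printed lower bound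
`∫_Q |w|³ ≥ ε⋆(N)/2 > 0` of the ancient solution (Seregin 2019, p. 8), which is how §4 concludes
"This is a contradiction. So, Proposition 1.3 is proved." [cite: Seregin2019, §4 p. 8] -/
theorem lintegral_cube_eq_zero_of_weakL3_ancient_top_vanishing {W : ℝ≥0∞} (hW : W ≠ ∞)
    (hw : ∀ a : ℝ, 0 < a → IsSuitableWeakSolutionInBall a (0 : ℝ × EuclideanSpace ℝ (Fin 3)) w π)
    (hw3 : ∀ a : ℝ, 0 < a → MemLp (uncurry w) 3
      (volume.restrict (parabolicCylinder a (0 : ℝ × EuclideanSpace ℝ (Fin 3)))))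
    (hweak : ∀ᵐ s ∂(volume.restrict (Iio (0 : ℝ))),
      AEStronglyMeasurable (w s) volume ∧ eWeakLpPow (w s) 3 volume ≤ W)
    (hG : ∃ G : ℝ → EuclideanSpace ℝ (Fin 3) → EuclideanSpace ℝ (Fin 3) →L[ℝ] EuclideanSpace ℝ (Fin 3),
      HasWeakSpatialGradientOn (slab (EuclideanSpace ℝ (Fin 3)) (Iio 0) isOpen_Iio) w G ∧
      ∀ T : ℝ, 0 < T → ∀ R : ℝ, 0 < R → ∃ C : ℝ≥0∞, C ≠ ∞ ∧ ∀ x₀ : EuclideanSpace ℝ (Fin 3),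
        ∫⁻ z in Ioo (-T) 0 ×ˢ ball x₀ R, ENNReal.ofReal (frobeniusNormSq (G z.1 z.2)) ≤ C)
    (htop : ∀ φ : EuclideanSpace ℝ (Fin 3) → EuclideanSpace ℝ (Fin 3), ContDiff ℝ (⊤ : ℕ∞) φ →
      HasCompactSupport φ → ∀ ε : ℝ, 0 < ε → ∃ s₁ : ℝ, s₁ < 0 ∧
        ∀ᵐ s ∂(volume.restrict (Ioo s₁ 0)), |∫ y, ⟪w s y, φ y⟫| ≤ ε)
    {a : ℝ} (ha : 0 < a) :
    ∫⁻ z in parabolicCylinder a (0 : ℝ × EuclideanSpace ℝ (Fin 3)), ‖w z.1 z.2‖ₑ ^ (3 : ℕ) = 0 := by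
  have hT : 0 < a ^ 2 := by positivity
  have hwz := ae_zero_of_weakL3_ancient_top_vanishing hW hw hw3 hweak hG htop hT
  have hsub : parabolicCylinder a (0 : ℝ × EuclideanSpace ℝ (Fin 3)) ⊆
      Ioo (-(a ^ 2)) 0 ×ˢ (univ : Set (EuclideanSpace ℝ (Fin 3))) := by
    rw [SuitableCompactness.parabolicCylinder_zero]
    exact prod_mono (by rw [neg_eq_neg_one_mul, ← neg_eq_neg_one_mul]) (subset_univ _)
  rw [lintegral_congr_ae ((ae_restrict_of_ae_restrict_of_subset hsub hwz).mono fun z hz => by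
    show ‖w z.1 z.2‖ₑ ^ (3 : ℕ) = (0 : ℝ≥0∞)
    rw [hz]; simp), lintegral_zero]

end Seregin2019

end Literature.Analysis.FluidPDE

end
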